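import Mathlib
import Summits.MatrixMultiplication.MatrixMultiplication.Theorems.SoloInformedValAveragedDefs

/-!
# Pratt's Proposition 4.8 example satisfies ALL THREE averaged trapezoid conditions
(file 2 of 3: the construction over `ℤ`)

K. Pratt, arXiv:2309.03878, §4.1.  Proposition 4.8 (proof) takes a 3AP-free `S ⊂ [n]` of size
`n^{1-o(1)}` and puts, "regarded as subsets of `ℤ_{100n²}`",
`A = B = [3n², 4n²] ∪ ⋃_{x∈S} [xn, xn + n/2]`,  `C = -{2xn + y : x ∈ S, y ∈ [n]}`,
shows `Σ_c r(A,B,-c) = Θ(|S|·n²)` solutions of `a + b + c = 0` (i.e. `N^{3/2-o(1)}` for the modulus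
`N = 100n²`) and the FIRST averaged condition `E_{a'∈A,b'∈B} #{(a,b,c) : 0 = a'+b+c = a+b'+c} ≤ 1`
(`Σ_c r(A,B,-c)² ≤ |A||B|`), and then asks (Question 4.9) for the maximum number of solutions under
all three averaged conditions.

Here: the same example, made carry-free and kept in `ℤ` (file 3 transports it into `ℤ_N`):
`h = ⌊(n-1)/2⌋`, `I_x = [xn, xn+h]`, `A = B = [3n², 4n²] ∪ ⋃_{x∈S} I_x`,
`C = ⋃_{x∈S} J_x`, `J_x = {-(2xn+y) : 1 ≤ y ≤ n-1}` (`S ⊆ {0,…,n-1}` 3AP-free).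
* `sol_structure`: every solution `a + b + c = 0` has `a, b ∈ I_x`, `c ∈ J_x` for ONE `x ∈ S`
  (Euclidean division by `n` + 3AP-freeness: `x₁ + x₂ = 2x₀ ⇒ x₁ = x₂ = x₀`; the pad `[3n²,4n²]`
  is too large to take part).
* Consequently every "codegree" is at most an interval length: through a fixed `c` pass `≤ h+1`
  solutions, through a fixed `b` (or `a`) pass `≤ h+1` choices of `a'` and `≤ n-1` choices of `c'`;
  with the second-moment identities of file 1 this gives
  `sumC ≤ |C|(h+1)² ≤ n⁴ ≤ |A||B|`, `sumB, sumA ≤ |S|(h+1)²(n-1) = (h+1)²|C| ≤ |A||C|`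
  (`construction_avgTrapezoidFree`) — the pad only serves to make `|A| = |B| ≥ n² + 1`.
* file 3, `card_sol_ge`: at least `|S|·((h+1)² - 1)` solutions
  (`(xn+y₁) + (xn+y₂) - (2xn+y₁+y₂) = 0`).

solo-informed MatrixMultiplication, gen 66.
-/

noncomputable section

namespace Summit.MatrixMultiplication.MatrixMultiplication.Theorems.SoloValAvg

open Finset

/-- Euclidean uniqueness: `q·n + r = q'·n + r'` with `0 ≤ r, r' < n` forces `q = q'` (and `r = r'`). -/
theorem euclid_unique {n q q' r r' : ℤ} (hr : 0 ≤ r) (hrn : r < n) (hr' : 0 ≤ r') (hrn' : r' < n)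
    (h : q * n + r = q' * n + r') : q = q' ∧ r = r' := by
  rcases lt_trichotomy q q' with hlt | heq | hgt
  · exfalso
    have h1 : (q + 1) * n ≤ q' * n := mul_le_mul_of_nonneg_right (by omega) (by omega)
    nlinarith
  · subst heq; exact ⟨rfl, by linarith⟩
  · exfalso
    have h1 : (q' + 1) * n ≤ q * n := mul_le_mul_of_nonneg_right (by omega) (by omega)
    nlinarith

section Construction

variable (n : ℕ) (S : Finset ℕ)

/-- Half-width `h = ⌊(n-1)/2⌋` of the short intervals (two offsets never carry past `n`). -/
def hw : ℕ := (n - 1) / 2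

/-- The short interval `I_x = [x·n, x·n + h]`. -/
def I (x : ℕ) : Finset ℤ := Icc ((x : ℤ) * n) ((x : ℤ) * n + hw n)

/-- The pad `[3n², 4n²]`: it takes part in no solution and only inflates `#A = #B`. -/
def pad : Finset ℤ := Icc (3 * (n : ℤ) ^ 2) (4 * (n : ℤ) ^ 2)

/-- `⋃_{x∈S} I_x`. -/
def part : Finset ℤ := S.biUnion (I n)

/-- `A = B = [3n², 4n²] ∪ ⋃_{x∈S} I_x`. -/
def setA : Finset ℤ := pad n ∪ part n S

/-- `J_x = {-(2xn + y) : 1 ≤ y ≤ n - 1}`. -/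
def J (x : ℕ) : Finset ℤ := (Icc (1 : ℤ) ((n : ℤ) - 1)).image (fun y => -(2 * (x : ℤ) * n + y))

/-- `C = ⋃_{x∈S} J_x = -{2xn + y : x ∈ S, 1 ≤ y ≤ n-1}`. -/
def setC : Finset ℤ := S.biUnion (J n)

variable {n S}

/-- `2h + 1 ≤ n`. -/
theorem two_hw_add_one_le (hn : 1 ≤ n) : 2 * hw n + 1 ≤ n := by unfold hw; omega

/-- Membership in `I_x`. -/
theorem mem_I {x : ℕ} {a : ℤ} : a ∈ I n x ↔ (x : ℤ) * n ≤ a ∧ a ≤ (x : ℤ) * n + hw n := by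
  simp [I]

/-- Membership in `J_x`. -/
theorem mem_J {x : ℕ} {c : ℤ} :
    c ∈ J n x ↔ ∃ y : ℤ, 1 ≤ y ∧ y ≤ n - 1 ∧ c = -(2 * (x : ℤ) * n + y) := by
  simp only [J, mem_image, mem_Icc]
  constructor
  · rintro ⟨y, ⟨h1, h2⟩, h⟩; exact ⟨y, h1, h2, h.symm⟩
  · rintro ⟨y, h1, h2, h⟩; exact ⟨y, ⟨h1, h2⟩, h.symm⟩

/-- Membership in `A`. -/
theorem mem_setA {a : ℤ} : a ∈ setA n S ↔ a ∈ pad n ∨ ∃ x ∈ S, a ∈ I n x := by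
  simp [setA, part]

/-- Membership in `C`. -/
theorem mem_setC {c : ℤ} : c ∈ setC n S ↔ ∃ x ∈ S, c ∈ J n x := by simp [setC]

/-- Elements of `A` are nonnegative. -/
theorem nonneg_of_mem_setA {a : ℤ} (h : a ∈ setA n S) : 0 ≤ a := by
  rcases mem_setA.1 h with hp | ⟨x, -, hx⟩
  · rw [pad, mem_Icc] at hp; nlinarith [hp.1]
  · rw [mem_I] at hx; nlinarith [hx.1]

/-- Two short intervals with a common element coincide. -/
theorem I_inj (hn : 1 ≤ n) {x x' : ℕ} {a : ℤ} (h : a ∈ I n x) (h' : a ∈ I n x') : x = x' := by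
  rw [mem_I] at h h'
  have hh : 2 * (hw n : ℤ) + 1 ≤ n := by exact_mod_cast two_hw_add_one_le hn
  have key := euclid_unique (n := (n : ℤ)) (q := (x : ℤ)) (q' := (x' : ℤ)) (r := a - x * n)
    (r' := a - x' * n) (by linarith) (by linarith) (by linarith) (by linarith) (by ring)
  exact_mod_cast key.1

/-- Two sets `J_x` with a common element coincide. -/
theorem J_inj {x x' : ℕ} {c : ℤ} (h : c ∈ J n x) (h' : c ∈ J n x') : x = x' := by
  obtain ⟨y, hy1, hy2, rfl⟩ := mem_J.1 h
  obtain ⟨y', hy1', hy2', e⟩ := mem_J.1 h'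
  have key := euclid_unique (n := (n : ℤ)) (q := 2 * (x : ℤ)) (q' := 2 * (x' : ℤ)) (r := y)
    (r' := y') (by linarith) (by linarith) (by linarith) (by linarith) (by linarith)
  have : (x : ℤ) = x' := by linarith [key.1]
  exact_mod_cast this

/-- A pad element lies in no short interval `I_x` with `x < n`. -/
theorem not_mem_I_of_mem_pad {x : ℕ} (hx : x < n) {a : ℤ} (hp : a ∈ pad n) (ha : a ∈ I n x) :
    False := by
  rw [pad, mem_Icc] at hp
  rw [mem_I] at ha
  have hh : (hw n : ℤ) ≤ n := by have := two_hw_add_one_le (n := n) (by omega); omega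
  have hxn : (x : ℤ) ≤ n - 1 := by omega
  have hn0 : (0 : ℤ) ≤ n := by positivity
  nlinarith [mul_le_mul_of_nonneg_right hxn hn0]

/-- **Structure of the solutions.**  If `a, b ∈ A`, `c ∈ C` and `a + b + c = 0` then for a single
`x ∈ S`: `a, b ∈ I_x` and `c ∈ J_x`.  (Write `c = -(2x₀n + y)`, `a ∈ I_{x₁}`, `b ∈ I_{x₂}` — the pad
is excluded by size; comparing quotients mod `n`, `x₁ + x₂ = 2x₀`, so `x₁ = x₂ = x₀` as `S` has no
3-term AP.) -/
theorem sol_structure (hn : 2 ≤ n) (h3 : ThreeAPFree (S : Set ℕ)) (hSn : ∀ x ∈ S, x < n)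
    {a b c : ℤ} (ha : a ∈ setA n S) (hb : b ∈ setA n S) (hc : c ∈ setC n S)
    (h : a + b + c = 0) : ∃ x ∈ S, a ∈ I n x ∧ b ∈ I n x ∧ c ∈ J n x := by
  obtain ⟨x₀, hx₀, hcJ⟩ := mem_setC.1 hc
  obtain ⟨y, hy1, hy2, rfl⟩ := mem_J.1 hcJ
  have hab : a + b = 2 * (x₀ : ℤ) * n + y := by linarith
  have hx₀n : (x₀ : ℤ) ≤ n - 1 := by have := hSn x₀ hx₀; omega
  have hn0 : (0 : ℤ) ≤ n := by positivity
  have hsmall : 2 * (x₀ : ℤ) * n + y < 3 * (n : ℤ) ^ 2 := by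
    nlinarith [mul_le_mul_of_nonneg_right hx₀n hn0]
  have ha0 := nonneg_of_mem_setA ha
  have hb0 := nonneg_of_mem_setA hb
  have haI : ∃ x ∈ S, a ∈ I n x := by
    rcases mem_setA.1 ha with hp | hI
    · exfalso; rw [pad, mem_Icc] at hp; linarith [hp.1]
    · exact hI
  have hbI : ∃ x ∈ S, b ∈ I n x := by
    rcases mem_setA.1 hb with hp | hI
    · exfalso; rw [pad, mem_Icc] at hp; linarith [hp.1]
    · exact hI
  obtain ⟨x₁, hx₁, ha₁⟩ := haI
  obtain ⟨x₂, hx₂, hb₂⟩ := hbI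
  have ha₁' := mem_I.1 ha₁
  have hb₂' := mem_I.1 hb₂
  have hwn : 2 * (hw n : ℤ) + 1 ≤ n := by exact_mod_cast two_hw_add_one_le (n := n) (by omega)
  have key := euclid_unique (n := (n : ℤ)) (q := (x₁ : ℤ) + x₂) (q' := 2 * (x₀ : ℤ))
    (r := a + b - ((x₁ : ℤ) + x₂) * n) (r' := y)
    (by nlinarith) (by nlinarith) (by linarith) (by linarith) (by linarith)
  have hsum : x₁ + x₂ = x₀ + x₀ := by have := key.1; omega
  have e₁ : x₁ = x₀ := h3 hx₁ hx₀ hx₂ hsum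
  have e₂ : x₂ = x₀ := by omega
  rw [e₁] at ha₁
  rw [e₂] at hb₂
  exact ⟨x₀, hx₀, ha₁, hb₂, hcJ⟩

/-! ### Codegree bounds: every fibre of the second-moment sums sits inside one interval -/

variable (hn : 2 ≤ n) (h3 : ThreeAPFree (S : Set ℕ)) (hSn : ∀ x ∈ S, x < n)
include hn h3 hSn

/-- Through a fixed `c ∈ J_x`: the `a'` (equivalently `b'`) of a solution lie in `I_x`. -/
theorem fibreC_subset {x : ℕ} (hx : x ∈ S) {c : ℤ} (hc : c ∈ J n x) :
    (setA n S).filter (fun a' => -a' - c ∈ setA n S) ⊆ I n x := by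
  intro a' h
  rw [mem_filter] at h
  obtain ⟨x', -, h1, -, h3'⟩ := sol_structure hn h3 hSn h.1 h.2 (mem_setC.2 ⟨x, hx, hc⟩)
    (by ring)
  rwa [J_inj hc h3']

/-- Through a fixed `b ∈ I_x`: the `a'` with `-a'-b ∈ C` lie in `I_x`. -/
theorem fibreB_left_subset {x : ℕ} (hx : x ∈ S) {b : ℤ} (hb : b ∈ I n x) :
    (setA n S).filter (fun a' => -a' - b ∈ setC n S) ⊆ I n x := by
  intro a' h
  rw [mem_filter] at h
  have hbA : b ∈ setA n S := mem_setA.2 (Or.inr ⟨x, hx, hb⟩)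
  obtain ⟨x', -, h1, h2, -⟩ := sol_structure hn h3 hSn h.1 hbA h.2 (by ring)
  rwa [I_inj (by omega) hb h2]

/-- Through a fixed `b ∈ I_x`: the `c'` with `-b-c' ∈ A` lie in `J_x`. -/
theorem fibreB_right_subset {x : ℕ} (hx : x ∈ S) {b : ℤ} (hb : b ∈ I n x) :
    (setC n S).filter (fun c' => -b - c' ∈ setA n S) ⊆ J n x := by
  intro c' h
  rw [mem_filter] at h
  have hbA : b ∈ setA n S := mem_setA.2 (Or.inr ⟨x, hx, hb⟩)
  obtain ⟨x', -, -, h2, h3'⟩ := sol_structure hn h3 hSn h.2 hbA h.1 (by ring)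
  rwa [I_inj (by omega) hb h2]

/-- Through a fixed `a ∈ I_x`: the `b'` with `-a-b' ∈ C` lie in `I_x`. -/
theorem fibreA_left_subset {x : ℕ} (hx : x ∈ S) {a : ℤ} (ha : a ∈ I n x) :
    (setA n S).filter (fun b' => -a - b' ∈ setC n S) ⊆ I n x := by
  intro b' h
  rw [mem_filter] at h
  have haA : a ∈ setA n S := mem_setA.2 (Or.inr ⟨x, hx, ha⟩)
  obtain ⟨x', -, h1, h2, -⟩ := sol_structure hn h3 hSn haA h.1 h.2 (by ring)
  rwa [I_inj (by omega) ha h1]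

/-- Through a fixed `a ∈ I_x`: the `c'` with `-a-c' ∈ B` lie in `J_x`. -/
theorem fibreA_right_subset {x : ℕ} (hx : x ∈ S) {a : ℤ} (ha : a ∈ I n x) :
    (setC n S).filter (fun c' => -a - c' ∈ setA n S) ⊆ J n x := by
  intro c' h
  rw [mem_filter] at h
  have haA : a ∈ setA n S := mem_setA.2 (Or.inr ⟨x, hx, ha⟩)
  obtain ⟨x', -, h1, -, h3'⟩ := sol_structure hn h3 hSn haA h.2 h.1 (by ring)
  rwa [I_inj (by omega) ha h1]

/-- A pad element is the `b` of no solution. -/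
theorem fibre_pad_left_eq_empty {b : ℤ} (hb : b ∈ pad n) :
    (setA n S).filter (fun a' => -a' - b ∈ setC n S) = ∅ := by
  rw [filter_eq_empty_iff]
  intro a' ha' h
  have hbA : b ∈ setA n S := mem_setA.2 (Or.inl hb)
  obtain ⟨x', hx', -, h2, -⟩ := sol_structure hn h3 hSn ha' hbA h (by ring)
  exact not_mem_I_of_mem_pad (hSn x' hx') hb h2

/-- A pad element is the `a` of no solution. -/
theorem fibre_pad_right_eq_empty {a : ℤ} (ha : a ∈ pad n) :
    (setA n S).filter (fun b' => -a - b' ∈ setC n S) = ∅ := by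
  rw [filter_eq_empty_iff]
  intro b' hb' h
  have haA : a ∈ setA n S := mem_setA.2 (Or.inl ha)
  obtain ⟨x', hx', h1, -, -⟩ := sol_structure hn h3 hSn haA hb' h (by ring)
  exact not_mem_I_of_mem_pad (hSn x' hx') ha h1

omit hn h3 hSn

/-! ### Cardinalities -/

/-- `#I_x = h + 1`. -/
theorem card_I (x : ℕ) : #(I n x) = hw n + 1 := by
  rw [I, Int.card_Icc]
  have : ((x : ℤ) * n + hw n + 1 - x * n) = ((hw n + 1 : ℕ) : ℤ) := by push_cast; ring
  rw [this, Int.toNat_natCast]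

/-- `#J_x = n - 1`. -/
theorem card_J (x : ℕ) : #(J n x) = n - 1 := by
  rw [J, card_image_of_injective _ (fun y y' (h : -(2 * (x : ℤ) * n + y) = -(2 * (x : ℤ) * n + y'))
    => by linarith), Int.card_Icc]
  omega

/-- `#C = #S · (n-1)`. -/
theorem card_setC : #(setC n S) = #S * (n - 1) := by
  rw [setC, card_biUnion (fun x _ x' _ hne => disjoint_left.2 fun c hc hc' =>
    hne (J_inj hc hc'))]
  simp [card_J]

/-- `#(⋃ I_x) ≤ #S · (h+1)`. -/
theorem card_part_le : #(part n S) ≤ #S * (hw n + 1) := by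
  refine (card_biUnion_le).trans ?_
  simp [card_I]

/-- `#pad = n² + 1`. -/
theorem card_pad : #(pad n) = n ^ 2 + 1 := by
  rw [pad, Int.card_Icc]
  have : (4 * (n : ℤ) ^ 2 + 1 - 3 * (n : ℤ) ^ 2) = ((n ^ 2 + 1 : ℕ) : ℤ) := by push_cast; ring
  rw [this, Int.toNat_natCast]

/-- `#A ≥ n² + 1`. -/
theorem card_setA_ge : n ^ 2 + 1 ≤ #(setA n S) := by
  rw [← card_pad (n := n)]
  exact card_le_card subset_union_left

/-- `(h+1)² ≤ #A`. -/
theorem hw_sq_le_card_setA (hn : 1 ≤ n) : (hw n + 1) * (hw n + 1) ≤ #(setA n S) := by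
  have h1 := two_hw_add_one_le hn
  have h2 := card_setA_ge (n := n) (S := S)
  nlinarith

/-! ### The three averaged conditions and the solution count -/

include hn h3 hSn

/-- First condition: `sumC ≤ #C·(h+1)² ≤ n⁴ ≤ #A·#B`. -/
theorem sumC_le : sumC (setA n S) (setA n S) (setC n S) ≤ #(setA n S) * #(setA n S) := by
  rw [sumC_eq]
  have hS : #S ≤ n := by
    calc #S ≤ #(range n) := card_le_card fun x hx => mem_range.2 (hSn x hx)
      _ = n := card_range n
  have hh : hw n + 1 ≤ n := by have := two_hw_add_one_le (n := n) (by omega); omega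
  calc ∑ c ∈ setC n S, #((setA n S).filter (fun a' => -a' - c ∈ setA n S)) *
          #((setA n S).filter (fun b' => -b' - c ∈ setA n S))
      ≤ ∑ c ∈ setC n S, (hw n + 1) * (hw n + 1) := by
        refine sum_le_sum fun c hc => ?_
        obtain ⟨x, hx, hcx⟩ := mem_setC.1 hc
        have h1 := card_le_card (fibreC_subset hn h3 hSn hx hcx)
        rw [card_I] at h1
        exact Nat.mul_le_mul h1 h1
    _ = #S * (n - 1) * ((hw n + 1) * (hw n + 1)) := by
        rw [sum_const, smul_eq_mul, card_setC]
    _ ≤ n * n * (n * n) := by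
        have h1 : n - 1 ≤ n := Nat.sub_le n 1
        gcongr
    _ ≤ #(setA n S) * #(setA n S) := by
        have h' : n * n ≤ #(setA n S) := by
          have := card_setA_ge (n := n) (S := S); nlinarith
        exact Nat.mul_le_mul h' h'

/-- Second condition: `sumB ≤ #S·(h+1)·(h+1)·(n-1) = (h+1)²·#C ≤ #A·#C`. -/
theorem sumB_le : sumB (setA n S) (setA n S) (setC n S) ≤ #(setA n S) * #(setC n S) := by
  rw [sumB_eq]
  set T : ℤ → ℕ := fun b => #((setA n S).filter (fun a' => -a' - b ∈ setC n S)) *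
    #((setC n S).filter (fun c' => -b - c' ∈ setA n S)) with hT
  have hdisj : Disjoint (pad n) (part n S) := by
    rw [disjoint_left]
    intro b hb hb'
    obtain ⟨x, hx, hbx⟩ := mem_biUnion.1 hb'
    exact not_mem_I_of_mem_pad (hSn x hx) hb hbx
  have hsplit : ∑ b ∈ setA n S, T b = ∑ b ∈ pad n, T b + ∑ b ∈ part n S, T b := sum_union hdisj
  have hpad : ∑ b ∈ pad n, T b = 0 := by
    refine sum_eq_zero fun b hb => ?_
    simp only [hT, fibre_pad_left_eq_empty hn h3 hSn hb, card_empty, zero_mul]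
  have hpart : ∑ b ∈ part n S, T b ≤ #(part n S) * ((hw n + 1) * (n - 1)) := by
    rw [← smul_eq_mul, ← sum_const]
    refine sum_le_sum fun b hb => ?_
    obtain ⟨x, hx, hbx⟩ := mem_biUnion.1 hb
    have h1 := card_le_card (fibreB_left_subset hn h3 hSn hx hbx)
    have h2 := card_le_card (fibreB_right_subset hn h3 hSn hx hbx)
    rw [card_I] at h1
    rw [card_J] at h2
    exact Nat.mul_le_mul h1 h2
  change ∑ b ∈ setA n S, T b ≤ _
  rw [hsplit, hpad, zero_add]
  refine hpart.trans ?_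
  calc #(part n S) * ((hw n + 1) * (n - 1)) ≤ #S * (hw n + 1) * ((hw n + 1) * (n - 1)) :=
        Nat.mul_le_mul_right _ card_part_le
    _ = (hw n + 1) * (hw n + 1) * (#S * (n - 1)) := by ring
    _ ≤ #(setA n S) * #(setC n S) := by
        rw [card_setC]
        exact Nat.mul_le_mul_right _ (hw_sq_le_card_setA (by omega))

/-- Third condition: `sumA ≤ (h+1)²·#C ≤ #B·#C` (mirror image of the second). -/
theorem sumA_le : sumA (setA n S) (setA n S) (setC n S) ≤ #(setA n S) * #(setC n S) := by
  rw [sumA_eq]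
  set T : ℤ → ℕ := fun a => #((setA n S).filter (fun b' => -a - b' ∈ setC n S)) *
    #((setC n S).filter (fun c' => -a - c' ∈ setA n S)) with hT
  have hdisj : Disjoint (pad n) (part n S) := by
    rw [disjoint_left]
    intro b hb hb'
    obtain ⟨x, hx, hbx⟩ := mem_biUnion.1 hb'
    exact not_mem_I_of_mem_pad (hSn x hx) hb hbx
  have hsplit : ∑ a ∈ setA n S, T a = ∑ a ∈ pad n, T a + ∑ a ∈ part n S, T a := sum_union hdisj
  have hpad : ∑ a ∈ pad n, T a = 0 := by
    refine sum_eq_zero fun a ha => ?_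
    simp only [hT, fibre_pad_right_eq_empty hn h3 hSn ha, card_empty, zero_mul]
  have hpart : ∑ a ∈ part n S, T a ≤ #(part n S) * ((hw n + 1) * (n - 1)) := by
    rw [← smul_eq_mul, ← sum_const]
    refine sum_le_sum fun a ha => ?_
    obtain ⟨x, hx, hax⟩ := mem_biUnion.1 ha
    have h1 := card_le_card (fibreA_left_subset hn h3 hSn hx hax)
    have h2 := card_le_card (fibreA_right_subset hn h3 hSn hx hax)
    rw [card_I] at h1
    rw [card_J] at h2
    exact Nat.mul_le_mul h1 h2
  change ∑ a ∈ setA n S, T a ≤ _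
  rw [hsplit, hpad, zero_add]
  refine hpart.trans ?_
  calc #(part n S) * ((hw n + 1) * (n - 1)) ≤ #S * (hw n + 1) * ((hw n + 1) * (n - 1)) :=
        Nat.mul_le_mul_right _ card_part_le
    _ = (hw n + 1) * (hw n + 1) * (#S * (n - 1)) := by ring
    _ ≤ #(setA n S) * #(setC n S) := by
        rw [card_setC]
        exact Nat.mul_le_mul_right _ (hw_sq_le_card_setA (by omega))

/-- **All three averaged trapezoid conditions hold** for `A = B = setA`, `C = setC`. -/
theorem construction_avgTrapezoidFree : AvgTrapezoidFree (setA n S) (setA n S) (setC n S) :=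
  ⟨sumC_le hn h3 hSn, sumB_le hn h3 hSn, sumA_le hn h3 hSn⟩

omit hn h3 hSn

end Construction

end Summit.MatrixMultiplication.MatrixMultiplication.Theorems.SoloValAvg

end
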